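/-
Copyright (c) 2026 the pub-hodgecm-mathlib formalisation cell (harness21).  Prover seat hodgecm-mathlib-K2Liu-p12 (g3): Track B «K2-LIT»,
#184♮ = hLiu418 = stmt-HodgeConjecture-24832; Road Φ of socket #41, organ Φ4-EXACT (LEAD F0P6-plan ruling «M-157p»), file E7:
the unimodular value in `L`-factor ∕ CM letters (LEAD F0P6-plan (g14) «=» 2026-09-04T11:33:17Z; census `K2/K2Liu-p12/g3/CENSUS-E7-UnimodularValueCM.K2Liu-p12-g3.md`).
-/
import Summits.HodgeConjecture.HodgeConjecture.Theorems.K2LiuGoodPlaceWhittakerUnimodularValueSplit   -- ★ E6-split `setIntegral_whittaker_unimodular_eq_split`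
import Summits.HodgeConjecture.HodgeConjecture.Theorems.K2LiuGoodPlaceWhittakerUnimodularValueInert   -- ★ E6-inert `setIntegral_whittaker_unimodular_eq_inert`
import Summits.HodgeConjecture.HodgeConjecture.Theorems.K2LiuGKRankOneIdentityLFactor               -- ★ `prod_norm_toPlace_uniformizer`, `prod_norm_toPlace_cpow`, `unramValue_chiF_eq_prod`
import Summits.HodgeConjecture.HodgeConjecture.Theorems.K2LiuA7NormaliserAlgebra                    -- ★ `bDen_two` over ★ T1 `K2LiuLocalLFactorDefs` (`chiF`, `chiNorm`, `lF`, `lEN`, `bDen`)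
import Literature.NumberTheory.Automorphic.AdicCompletionDegreeOnePlaceEquiv                         -- ★ `absNorm_eq_absNorm_under_of_smul_ne` (`q_w = q_v` at a split place)
import HarnessLib

/-!
# Crux `HLiu418`, Road Φ of socket #41, organ Φ4-EXACT — FILE E7: THE UNIMODULAR UNRAMIFIED WHITTAKER VALUE IN `L`-FACTOR AND CM LETTERS
# `W°_{β,v}(φ_s) = μ(B(0)) · b_{2,v}(s, χ)⁻¹`,  `b_2(s,χ) = L_F(2s+2, χ_F) · L_F(2s+1, χ_F η)`;  under parity: `μ(B(0))·(1 − q_v^{−(2s+1)})(1 − ε(ϖ_v) q_v^{−(2s+2)})`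

Cell `hodgecm-mathlib`, crux item hLiu418 = `stmt-HodgeConjecture-24832`, route of record `HCCMUnconditional`; squad K2 ∕ K2Liu, road `K2_Liu`,
socket #41 `sig_K2LiuSiegelEisensteinContinuation`, Road Φ, organ Φ4-EXACT (ruling M-157p), consumer = the Φ9 sheet's row G2 (`hP1`: «β `v`-unimodular ⇒
`W° = μ(B(0))·b_v(s)⁻¹`», `1∕b^T` = ★ O41.6 `K2LiuSiegelIntertwiningScalarGL1.hasProd_b`).  THEOREMS ONLY (no `def`, no `instance`, no `notation`, no named-fact
hypothesis, no `sorry`); lane `--supports stmt-HodgeConjecture-24832` (count-neutral helper; closes no socket by itself).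

THE MATHEMATICS.  ★ E6-split ∕ ★ E6-inert compute, at a good unramified place `v` of `F` in the quadratic extension `E/F` and for a `v`-unimodular
`T`-skew index `β`, the spherical Whittaker integral `W° := ∫_{B(−3)} φ_s(w_Δ n t) ψ_v(−τ tr(βt)) dμ = μ(B(0))·(1 − T)(1 − η_v q_v T)` with the RAW parameter
`T = α · P^{s+1}`, `α = ∏_{w∣v} χ_w(ι_w ϖ)`, `P = ∏_{w∣v} ‖ι_w ϖ‖_w`, `η_v = +1` (split) ∕ `−1` (inert), `q_v = v.residueCard`.  This file is the DICTIONARY to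
the `L`-factor currency of record (★ T1 `K2LiuLocalLFactorDefs`, RULING M-156i) — the `n = 2` Whittaker twin of ★ `K2LiuGKRankOneIdentityLFactor.rankOne_scalar_eq`:
* §1 the norm letter `P^{s+1} = q_v^{−(2s+2)}` (★ `prod_norm_toPlace_uniformizer`: `P = q_v⁻²`, local norm compatibility) and the residue cardinalities
  `q_{w₀} = q_v²` (inert) ∕ `q_w = q_v` (split);
* §2 the Satake value of the norm twist `χ_w·(χ_{cw}∘c_w)` (★ T1 `chiNorm`): `a_w · a_{cw}`, `a_w = χ_w(ι_w ϖ)`;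
* §3 `L_{E/F,v}(z, χ_F∘N) = lEN χv z` in closed form: `(1 − α² q_v^{−z} q_v^{−z})⁻¹` (inert), `((1 − α q_v^{−z})⁻¹)²` (split);
* §4 `b_{2,v}(s,χ)⁻¹ = (bDen F E c v 2 χv s)⁻¹ = (1 − T)(1 − η_v q_v T)` (split: no side condition; inert: off the line `α q_v^{−(2s+1)} = 1`, where Lean's
  junk value `bDen = 0` differs from the true value `2(1 − T)`);
* §5 **THE `L`-FACTOR HEADS** `setIntegral_whittaker_unimodular_eq_bDen_inv_split ∕ _inert`: **`W° = μ(B(0)) · (bDen F E c v 2 χv s)⁻¹`** for EVERY family of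
  unramified `χ_w` (convention-free: `b_2(s,χ) = L_F(2s+2, χ_F)·L_F(2s+1, χ_F η_{E/F})`, [HarrisKudlaSweet1996 §6 (6.16)], value `1∕b` [Liu2011 (2-10)]);
* §6 **THE PARITY FORM** `…_of_parity_inert (hα : α = −1)` ∕ `…_of_parity_split (hα : α = 1)`:
  **`W° = μ(B(0)) · ((1 − q_v^{−(2s+1)}) · (1 − α · q_v^{−(2s+2)}))`** — after the consumer's one rewrite `α = ε(ϖ_v)` (parity `χ|_{𝔸_F^×} = ε_{E/F}` of the
  K2_Liu frame, REPORT-FIRST #41 (B4), ★ `IsSplittingChar`; dictionary ★ `K2E1QuadraticHeckeCharCMPlaceValues`: `ε(ϖ_v) = −1` inert, `+1` split) this is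
  `μ(B(0))` times the inverse of the `v`-factor `(1 − q_v^{−(2s+1)})⁻¹(1 − ε(ϖ_v) q_v^{−(2s+2)})⁻¹` of ★ O41.6 `hasProd_b` — RULING M-157p's printed bytes
  `W°_{β,v}(1,s) = μ(B(0))·(1 − q_v^{−(2s+1)})(1 − ε(ϖ_v)q_v^{−(2s+2)})`.
CONVENTION NOTE (K2Liu-ref1 AUDIT (A-E) (C1)): the parity factors are those of `χ⁰ = ε` (ours ∕ Harris (1.3.4) with `χ|_𝔸 = ε^{n+1}`), NOT Liu 2011 (2-2) verbatim (`χ⁰ = 1`);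
the convention-free statement is §5.  MEASURE (C2): arbitrary Haar `μ` on the skew lattice, factor `μ(B(0))` kept.
HONEST LABEL.  Count-neutral helper; it retires nothing by itself: `HC_CM` is proved only modulo the 7 printed citations (2 remaining named inputs:
hLiu418 = `stmt-HodgeConjecture-24832`, h413 = `stmt-HodgeConjecture-24833`) until rung 0 closes.

## References
* [HarrisKudlaSweet1996] M. Harris, S. Kudla, W. J. Sweet, *Theta dichotomy for unitary groups*, J. AMS 9 (1996): §6 (6.14)–(6.16) (`b_n(s,χ) = ∏_{r<n} L(2s+n−r, χ⁰ε^r)`).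
* [Liu2011] Y. Liu, *Arithmetic theta lifting and L-derivatives for unitary groups, I*, Algebra Number Theory 5 (2011): §2A p. 929 (`s + n∕2`), p. 936 (2-10) (`W_T(e, φ°) = 1∕b`).
* [Harris2007] M. Harris, *Cohomological automorphic forms on unitary groups, II* (Howe volume, 2007): (1.3.4) p. 92 (`χ⁰`-dependent `b_n`).
* [KudlaSweet1997] S. Kudla, W. J. Sweet, Israel J. Math. 98 (1997): §1.   * [Shimura1997] G. Shimura, CBMS 93 (1997): Thm. 13.6, Prop. 14.9.
* [CasselsFrohlichANT1967] Cassels–Fröhlich, *Algebraic Number Theory* (1967): Ch. II §11 (`∏_{w∣v}‖ι_w y‖_w = ‖y‖_v^{[E:F]}`), Ch. VII Prop. 1.2.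
-/

set_option autoImplicit false
-- the mandated namespace repeats the single-problem summit's segment (`HodgeConjecture.HodgeConjecture`)
set_option linter.dupNamespace false

noncomputable section

open scoped NNReal ENNReal Matrix Topology
open NumberField IsDedekindDomain Matrix MeasureTheory Set Filter
open Literature.NumberTheory.GaloisRepresentations Literature.NumberTheory.GaloisRepresentations.IsNonarchimedeanLocalField
open Literature.NumberTheory.GaloisRepresentations.Ultrametric.AdicCompletion (norm_eq_absNorm_zpow)
open Literature.NumberTheory.Automorphic Literature.NumberTheory.Automorphic.UnitaryGroup
open Literature.NumberTheory.GelbartRogawski1991.AdaptedBlocks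
open Literature.NumberTheory.GelbartRogawski1991.UnitaryDualPair.LocalSplitting
open Literature.NumberTheory.K2Lit.LocalSiegelDoubled
open Summit.HodgeConjecture.HodgeConjecture.Cruxes.HLiu418.K2LiuLocalLFactorDefs
open Summit.HodgeConjecture.HodgeConjecture.Cruxes.HLiu418.K2LiuGKRankOneIdentityLFactor
open Summit.HodgeConjecture.HodgeConjecture.Cruxes.HLiu418.K2LiuA7NormaliserAlgebra
open Summit.HodgeConjecture.HodgeConjecture.Cruxes.HLiu418.K2LiuGoodPlaceWhittakerUnimodularValueSplit
open Summit.HodgeConjecture.HodgeConjecture.Cruxes.HLiu418.K2LiuGoodPlaceWhittakerUnimodularValueInert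

namespace Summit.HodgeConjecture.HodgeConjecture.Cruxes.HLiu418.K2LiuGoodPlaceWhittakerUnimodularValueCM

variable (F : Type) [Field F] [NumberField F] (E : Type) [Field E] [NumberField E] [Algebra F E]
  [Algebra.IsQuadraticExtension F E] (c : E ≃ₐ[F] E) {δ : E} (hcδ : c δ = -δ) (hδ : δ ≠ 0)
  (v : HeightOneSpectrum (𝓞 F))
  {π : v.adicCompletion F} (hπ : Valued.v π = WithZero.exp (-1 : ℤ)) (hπw : ∀ w : PlacesOver E v, Valued.v (toPlace v w π) = WithZero.exp (-1 : ℤ))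

/-! ## §1 The norm letter `P^{s+1} = q_v^{−(2s+2)}` and the residue cardinalities above an unramified `v` -/

/-- `1 < q_v` (real form, `q_v = v.residueCard`). [folklore] -/
theorem one_lt_residueCard : (1 : ℝ) < (v.residueCard : ℝ) := by
  have h := one_lt_residueFieldCard F v
  rwa [residueFieldCard_adicCompletion_eq F v] at h

/-- `q_v ≠ 0` in `ℂ`. [folklore] -/
theorem residueCard_ne_zero : (v.residueCard : ℂ) ≠ 0 := by
  have h := one_lt_residueCard F v
  exact_mod_cast (lt_trans one_pos h).ne'

include hπ in
/-- **THE NORM LETTER `(∏_{w∣v} ‖ι_w ϖ‖_w)^{s+1} = q_v^{−(2s+2)}`** (★ `prod_norm_toPlace_cpow` at `s + ½`: `∏_{w∣v}‖ι_w ϖ‖_w = q_v⁻²` by local norm compatibility,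
`q(F_v) = v.residueCard` ★ `residueFieldCard_adicCompletion_eq`) — the exponent `s + n∕2 = s + 1` of `I_2(s, χ)`. [cite: CasselsFrohlichANT1967, Ch. II §11] [cite: Liu2011, §2A p. 929] -/
theorem prod_norm_toPlace_cpow_add_one (s : ℂ) :
    (((∏ w : PlacesOver E v, ‖toPlace v w π‖) : ℝ) : ℂ) ^ (s + 1) = (v.residueCard : ℂ) ^ (-(2 * s + 2)) := by
  rw [show s + 1 = (s + 1 / 2) + 1 / 2 by ring, prod_norm_toPlace_cpow F E v hπ (s + 1 / 2), residueFieldCard_adicCompletion_eq F v]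
  congr 1
  ring

omit [Algebra.IsQuadraticExtension F E] in
include hπw in
/-- `‖ι_w ϖ‖_w = q_w⁻¹` when `ι_w ϖ` is a uniformizer of `E_w` (`v` unramified at `w`). [cite: CasselsFrohlichANT1967, Ch. II §11] -/
theorem norm_toPlace_eq_inv (w : PlacesOver E v) : ‖toPlace v w π‖ = ((w.1.residueCard : ℝ))⁻¹ := by
  rw [norm_eq_absNorm_zpow E w.1 (-1) (by rw [hπw w, WithZero.exp]), _root_.zpow_neg, zpow_one,
    ← residueFieldCard_adicCompletion_eq_absNorm E w.1, residueFieldCard_adicCompletion_eq E w.1]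

include hcδ hδ hπ hπw in
/-- **`q_{w₀} = q_v²` at an INERT unramified place** (`c • w₀ = w₀`: `w₀` is the only place above `v`, ★ `PlacesOver.eq_of_smul_eq`, `c ≠ 1` ★ `galConj_ne_one_of_delta`; then `q_{w₀}⁻¹ = ‖ι_{w₀} ϖ‖ =
∏_w ‖ι_w ϖ‖ = q_v⁻²`). [cite: CasselsFrohlichANT1967, Ch. II §11] -/
theorem residueCard_eq_sq_of_inert (w₀ : PlacesOver E v) (hw₀ : c • w₀.1 = w₀.1) : w₀.1.residueCard = v.residueCard ^ 2 := by
  haveI := PlacesOver.subsingleton_of_smul_eq c (galConj_ne_one_of_delta F E c hcδ hδ) w₀ hw₀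
  have h := prod_norm_toPlace_uniformizer F E v hπ
  rw [Fintype.prod_subsingleton _ w₀, norm_toPlace_eq_inv F E v hπw w₀, residueFieldCard_adicCompletion_eq F v, inv_pow] at h
  have h' : ((w₀.1.residueCard : ℕ) : ℝ) = ((v.residueCard ^ 2 : ℕ) : ℝ) := by rw [Nat.cast_pow]; exact inv_injective h
  exact_mod_cast h'

/-- **`q_w = q_v` at a SPLIT place** (`c • w ≠ w`; ★ `absNorm_eq_absNorm_under_of_smul_ne`: `f(w|v) = 1`). [cite: CasselsFrohlichANT1967, Ch. VII Prop. 1.2] -/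
theorem residueCard_eq_of_split (w : PlacesOver E v) (hw : c • w.1 ≠ w.1) : w.1.residueCard = v.residueCard := by
  have h := absNorm_eq_absNorm_under_of_smul_ne F c hw
  rw [w.2] at h
  exact h


/-! ## §2 The Satake value of the norm twist `χ_w · (χ_{cw} ∘ c_w)` at the uniformizer `ι_w ϖ` -/

omit [Algebra.IsQuadraticExtension F E] in
/-- the norm twist `χ_w·(χ_{cw}∘c_w)` (★ T1 `chiNorm`) is unramified when every `χ_w` is (`c_w` preserves `|·|`, ★ `valued_galAdicCompletionMap`).
[cite: HarrisKudlaSweet1996, §6 (6.16)] -/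
theorem isUnramifiedChar_chiNorm {χv : ∀ w : PlacesOver E v, (w.1.adicCompletion E)ˣ →* ℂˣ}
    (hχur : ∀ (w : PlacesOver E v) (x : (w.1.adicCompletion E)ˣ), Valued.v (x : w.1.adicCompletion E) = 1 → χv w x = 1)
    (w : PlacesOver E v) : IsUnramifiedChar (chiNorm F E c v χv w) := by
  intro u hu
  rw [chiNorm_apply, hχur w u hu, one_mul]
  refine hχur _ _ ?_
  change Valued.v (galAdicCompletionMap (L := E) c (rfl : c • w.1 = (galPlace c w).1) (u : w.1.adicCompletion E)) = 1
  rw [valued_galAdicCompletionMap, hu]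

omit [Algebra.IsQuadraticExtension F E] in
include hπw in
/-- **the Satake value of the norm twist**: `(χ_w·(χ_{cw}∘c_w))(ι_w ϖ) = a_w · a_{cw}`, `a_w := χ_w(ι_w ϖ)` (`c_w ι_w = ι_{cw}` ★ `galAdicCompletionMap_toPlace`;
`ι_w ϖ` is a uniformizer of `E_w` by `hπw`). [cite: HarrisKudlaSweet1996, §6 (6.16)] [cite: CasselsFrohlichANT1967, Ch. VII Prop. 1.2] -/
theorem unramValue_chiNorm_eq {χv : ∀ w : PlacesOver E v, (w.1.adicCompletion E)ˣ →* ℂˣ}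
    (hχur : ∀ (w : PlacesOver E v) (x : (w.1.adicCompletion E)ˣ), Valued.v (x : w.1.adicCompletion E) = 1 → χv w x = 1)
    (hϖ0 : ∀ w : PlacesOver E v, toPlace v w π ≠ 0) (w : PlacesOver E v) :
    unramValue E w.1 (chiNorm F E c v χv w) =
      (((χv w (Units.mk0 (toPlace v w π) (hϖ0 w))) : ℂˣ) : ℂ) *
        (((χv (galPlace c w) (Units.mk0 (toPlace v (galPlace c w) π) (hϖ0 (galPlace c w)))) : ℂˣ) : ℂ) := by
  have hmap : Units.map ((galAdicCompletionMap (L := E) c (rfl : c • w.1 = (galPlace c w).1)).toMonoidHom :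
        w.1.adicCompletion E →* (galPlace c w).1.adicCompletion E) (Units.mk0 (toPlace v w π) (hϖ0 w)) =
      Units.mk0 (toPlace v (galPlace c w) π) (hϖ0 (galPlace c w)) :=
    Units.ext (galAdicCompletionMap_toPlace c w (galPlace c w) rfl π)
  rw [unramValue_eq_apply E w.1 (isUnramifiedChar_chiNorm F E c v hχur w) (hπw w) (hϖ0 w), chiNorm_apply, hmap, Units.val_mul]

/-! ## §3 `L_{E/F,v}(z, χ_F∘N) = lEN χv z` in closed form at an inert and at a split place -/

include hcδ hδ hπ hπw in
/-- **INERT: `L_{E/F,v}(z, χ_F∘N) = (1 − α² q_v^{−z} q_v^{−z})⁻¹`**, `α = ∏_{w∣v} χ_w(ι_w ϖ)` (one place `w₀` above `v` ★ `PlacesOver.eq_of_smul_eq`, Satake value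
`a_{w₀}² = α²` by §2, `q_{w₀} = q_v²` by §1). [cite: HarrisKudlaSweet1996, §6 (6.16)] [cite: CasselsFrohlichANT1967, Ch. VII Prop. 1.2] -/
theorem lEN_eq_of_inert {χv : ∀ w : PlacesOver E v, (w.1.adicCompletion E)ˣ →* ℂˣ}
    (hχur : ∀ (w : PlacesOver E v) (x : (w.1.adicCompletion E)ˣ), Valued.v (x : w.1.adicCompletion E) = 1 → χv w x = 1)
    (hϖ0 : ∀ w : PlacesOver E v, toPlace v w π ≠ 0) (w₀ : PlacesOver E v) (hw₀ : c • w₀.1 = w₀.1) (z : ℂ) :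
    lEN F E c v χv z =
      (1 - (((∏ w : PlacesOver E v, χv w (Units.mk0 (toPlace v w π) (hϖ0 w))) : ℂˣ) : ℂ) ^ 2 *
        ((v.residueCard : ℂ) ^ (-z) * (v.residueCard : ℂ) ^ (-z)))⁻¹ := by
  haveI := PlacesOver.subsingleton_of_smul_eq c (galConj_ne_one_of_delta F E c hcδ hδ) w₀ hw₀
  have hgal : galPlace c w₀ = w₀ := Subsingleton.elim _ _
  have hfac : (((χv (galPlace c w₀) (Units.mk0 (toPlace v (galPlace c w₀) π) (hϖ0 (galPlace c w₀)))) : ℂˣ) : ℂ) =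
      (((χv w₀ (Units.mk0 (toPlace v w₀ π) (hϖ0 w₀))) : ℂˣ) : ℂ) :=
    congrArg (fun w' : PlacesOver E v => (((χv w' (Units.mk0 (toPlace v w' π) (hϖ0 w'))) : ℂˣ) : ℂ)) hgal
  rw [lEN, Fintype.prod_subsingleton _ w₀, Fintype.prod_subsingleton _ w₀, lFactor_def,
    unramValue_chiNorm_eq F E c v hπw hχur hϖ0 w₀, hfac, residueFieldCard_adicCompletion_eq E w₀.1,
    residueCard_eq_sq_of_inert F E c hcδ hδ v hπ hπw w₀ hw₀, sq, Nat.cast_mul, Complex.natCast_mul_natCast_cpow]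
  ring

include hπw in
/-- **SPLIT: `L_{E/F,v}(z, χ_F∘N) = ((1 − α q_v^{−z})⁻¹)²`**, `α = ∏_{w∣v} χ_w(ι_w ϖ) = a_{w₀} a_{w̄₀}` (two places `w₀ ≠ w̄₀ = c w₀` ★ `PlacesOver.eq_or_eq_galInv`; both norm
twists have Satake value `a_{w₀} a_{w̄₀}` by §2; `q_{w₀} = q_{w̄₀} = q_v` by §1). [cite: HarrisKudlaSweet1996, §6 (6.16)] [cite: CasselsFrohlichANT1967, Ch. VII Prop. 1.2] -/
theorem lEN_eq_of_split {χv : ∀ w : PlacesOver E v, (w.1.adicCompletion E)ˣ →* ℂˣ}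
    (hχur : ∀ (w : PlacesOver E v) (x : (w.1.adicCompletion E)ˣ), Valued.v (x : w.1.adicCompletion E) = 1 → χv w x = 1)
    (hϖ0 : ∀ w : PlacesOver E v, toPlace v w π ≠ 0) (w₀ : PlacesOver E v) (hw₀ : c • w₀.1 ≠ w₀.1) (z : ℂ) :
    lEN F E c v χv z =
      ((1 - (((∏ w : PlacesOver E v, χv w (Units.mk0 (toPlace v w π) (hϖ0 w))) : ℂˣ) : ℂ) * (v.residueCard : ℂ) ^ (-z))⁻¹) ^ 2 := by
  classical
  have hc : c ≠ 1 := by rintro rfl; exact hw₀ (one_smul _ _)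
  have hne : PlacesOver.galInv c w₀ ≠ w₀ := PlacesOver.galInv_ne c w₀ hw₀
  have huniv : (Finset.univ : Finset (PlacesOver E v)) = {w₀, PlacesOver.galInv c w₀} := by
    ext w'
    simp only [Finset.mem_univ, Finset.mem_insert, Finset.mem_singleton, true_iff]
    exact PlacesOver.eq_or_eq_galInv c hc w₀ w'
  have hg0 : galPlace c w₀ = PlacesOver.galInv c w₀ :=
    Subtype.ext (by change c • w₀.1 = c⁻¹ • w₀.1; rw [algEquiv_inv_eq_self F hc])
  have hg1 : galPlace c (PlacesOver.galInv c w₀) = w₀ := Subtype.ext (smul_inv_smul c w₀.1)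
  have hfac0 := congrArg (fun w' : PlacesOver E v => (((χv w' (Units.mk0 (toPlace v w' π) (hϖ0 w'))) : ℂˣ) : ℂ)) hg0
  have hfac1 := congrArg (fun w' : PlacesOver E v => (((χv w' (Units.mk0 (toPlace v w' π) (hϖ0 w'))) : ℂˣ) : ℂ)) hg1
  simp only at hfac0 hfac1
  have hprod : (((∏ w : PlacesOver E v, χv w (Units.mk0 (toPlace v w π) (hϖ0 w))) : ℂˣ) : ℂ) =
      (((χv w₀ (Units.mk0 (toPlace v w₀ π) (hϖ0 w₀))) : ℂˣ) : ℂ) *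
        (((χv (PlacesOver.galInv c w₀) (Units.mk0 (toPlace v (PlacesOver.galInv c w₀) π) (hϖ0 (PlacesOver.galInv c w₀)))) : ℂˣ) : ℂ) := by
    rw [← Units.val_mul]
    congr 1
    rw [huniv, Finset.prod_pair hne.symm]
  rw [hprod, lEN, huniv, Finset.prod_pair hne.symm, lFactor_def, lFactor_def, unramValue_chiNorm_eq F E c v hπw hχur hϖ0 w₀,
    unramValue_chiNorm_eq F E c v hπw hχur hϖ0 (PlacesOver.galInv c w₀), hfac0, hfac1, residueFieldCard_adicCompletion_eq E w₀.1,
    residueFieldCard_adicCompletion_eq E (PlacesOver.galInv c w₀).1, residueCard_eq_of_split F E c v w₀ hw₀,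
    residueCard_eq_of_split F E c v (PlacesOver.galInv c w₀) (smul_galInv_ne F E c v w₀ hw₀)]
  ring

/-! ## §4 `b_{2,v}(s, χ)⁻¹ = (1 − T)(1 − η_v q_v T)`, `T = α · (∏_w ‖ι_w ϖ‖_w)^{s+1}` -/

/-- `q_v · q_v^{−(2s+2)} = q_v^{−(2s+1)}`. [folklore] -/
theorem residueCard_mul_cpow (s : ℂ) :
    (v.residueCard : ℂ) * (v.residueCard : ℂ) ^ (-(2 * s + 2)) = (v.residueCard : ℂ) ^ (-(2 * s + 1)) := by
  rw [show -(2 * s + 1) = 1 + -(2 * s + 2) by ring, Complex.cpow_add _ _ (residueCard_ne_zero F v), Complex.cpow_one]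

include hπ hπw in
/-- **SPLIT: `b_{2,v}(s,χ)⁻¹ = (1 − T)(1 − q_v T)`** with `T = α·(∏_w‖ι_w ϖ‖_w)^{s+1} = α q_v^{−(2s+2)}` — NO side condition (on the line `α q_v^{−(2s+1)} = 1` both sides
are `0`): `bDen 2 = L_F(2s+2,χ_F)·L_{E/F}(2s+1,χ_F∘N)/L_F(2s+1,χ_F)` (★ `bDen_two`) with §3-split. [cite: HarrisKudlaSweet1996, §6 (6.16)] [cite: Liu2011, §2A (2-10)] -/
theorem bDen_two_inv_eq_of_split {χv : ∀ w : PlacesOver E v, (w.1.adicCompletion E)ˣ →* ℂˣ}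
    (hχur : ∀ (w : PlacesOver E v) (x : (w.1.adicCompletion E)ˣ), Valued.v (x : w.1.adicCompletion E) = 1 → χv w x = 1)
    (hϖ0 : ∀ w : PlacesOver E v, toPlace v w π ≠ 0) (w₀ : PlacesOver E v) (hw₀ : c • w₀.1 ≠ w₀.1) (s : ℂ) :
    (bDen F E c v 2 χv s)⁻¹ =
      (1 - (((∏ w : PlacesOver E v, χv w (Units.mk0 (toPlace v w π) (hϖ0 w))) : ℂˣ) : ℂ) *
          (((∏ w : PlacesOver E v, ‖toPlace v w π‖) : ℝ) : ℂ) ^ (s + 1)) *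
        (1 - (v.residueCard : ℂ) * ((((∏ w : PlacesOver E v, χv w (Units.mk0 (toPlace v w π) (hϖ0 w))) : ℂˣ) : ℂ) *
          (((∏ w : PlacesOver E v, ‖toPlace v w π‖) : ℝ) : ℂ) ^ (s + 1))) := by
  rw [bDen_two, lEN_eq_of_split F E c v hπw hχur hϖ0 w₀ hw₀, lF, lF, lFactor_def, lFactor_def, unramValue_chiF_eq_prod F E v χv hχur hπ hϖ0,
    residueFieldCard_adicCompletion_eq F v, prod_norm_toPlace_cpow_add_one F E v hπ s, ← mul_assoc (v.residueCard : ℂ),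
    mul_comm (v.residueCard : ℂ), mul_assoc, residueCard_mul_cpow F v s]
  set A : ℂ := 1 - (((∏ w : PlacesOver E v, χv w (Units.mk0 (toPlace v w π) (hϖ0 w))) : ℂˣ) : ℂ) * (v.residueCard : ℂ) ^ (-(2 * s + 2))
  set B : ℂ := 1 - (((∏ w : PlacesOver E v, χv w (Units.mk0 (toPlace v w π) (hϖ0 w))) : ℂˣ) : ℂ) * (v.residueCard : ℂ) ^ (-(2 * s + 1))
  by_cases hB : B = 0
  · rw [hB]; simp
  · rw [sq, mul_div_assoc, div_self (inv_ne_zero hB), mul_one, mul_inv, inv_inv, inv_inv]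

include hcδ hδ hπ hπw in
/-- **INERT: `b_{2,v}(s,χ)⁻¹ = (1 − T)(1 + q_v T)`** with `T = α q_v^{−(2s+2)}`, OFF the line `α·q_v^{−(2s+1)} = 1` (there Lean's `bDen 2 χv s = 0` while the value is
`2(1 − T)`; the line is empty for unitary `χ_w` and `re s ≠ −½`): `L_{E/F}(2s+1)/L_F(2s+1) = (1 − αX)/(1 − α²X²) = (1 + αX)⁻¹`, `X = q_v^{−(2s+1)}`.
[cite: HarrisKudlaSweet1996, §6 (6.16)] [cite: Liu2011, §2A (2-10)] -/
theorem bDen_two_inv_eq_of_inert {χv : ∀ w : PlacesOver E v, (w.1.adicCompletion E)ˣ →* ℂˣ}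
    (hχur : ∀ (w : PlacesOver E v) (x : (w.1.adicCompletion E)ˣ), Valued.v (x : w.1.adicCompletion E) = 1 → χv w x = 1)
    (hϖ0 : ∀ w : PlacesOver E v, toPlace v w π ≠ 0) (w₀ : PlacesOver E v) (hw₀ : c • w₀.1 = w₀.1) (s : ℂ)
    (hne : (((∏ w : PlacesOver E v, χv w (Units.mk0 (toPlace v w π) (hϖ0 w))) : ℂˣ) : ℂ) * (v.residueCard : ℂ) ^ (-(2 * s + 1)) ≠ 1) :
    (bDen F E c v 2 χv s)⁻¹ =
      (1 - (((∏ w : PlacesOver E v, χv w (Units.mk0 (toPlace v w π) (hϖ0 w))) : ℂˣ) : ℂ) *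
          (((∏ w : PlacesOver E v, ‖toPlace v w π‖) : ℝ) : ℂ) ^ (s + 1)) *
        (1 + (v.residueCard : ℂ) * ((((∏ w : PlacesOver E v, χv w (Units.mk0 (toPlace v w π) (hϖ0 w))) : ℂˣ) : ℂ) *
          (((∏ w : PlacesOver E v, ‖toPlace v w π‖) : ℝ) : ℂ) ^ (s + 1))) := by
  rw [bDen_two, lEN_eq_of_inert F E c hcδ hδ v hπ hπw hχur hϖ0 w₀ hw₀, lF, lF, lFactor_def, lFactor_def,
    unramValue_chiF_eq_prod F E v χv hχur hπ hϖ0, residueFieldCard_adicCompletion_eq F v, prod_norm_toPlace_cpow_add_one F E v hπ s,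
    ← mul_assoc (v.residueCard : ℂ), mul_comm (v.residueCard : ℂ), mul_assoc, residueCard_mul_cpow F v s]
  set α : ℂ := (((∏ w : PlacesOver E v, χv w (Units.mk0 (toPlace v w π) (hϖ0 w))) : ℂˣ) : ℂ)
  set X : ℂ := (v.residueCard : ℂ) ^ (-(2 * s + 1))
  set Y : ℂ := (v.residueCard : ℂ) ^ (-(2 * s + 2))
  have hB : 1 - α * X ≠ 0 := sub_ne_zero.2 (Ne.symm hne)
  rw [show 1 - α ^ 2 * (X * X) = (1 - α * X) * (1 + α * X) by ring]
  by_cases hC : 1 + α * X = 0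
  · rw [hC]; simp
  · field_simp

/-! ## §5 THE `L`-FACTOR HEADS: `W°_{β,v}(φ_s) = μ(B(0)) · b_{2,v}(s, χ)⁻¹` at every good unramified place -/

section Heads

/-! The letters of ★ E5∕E6 (`K2LiuGoodPlaceWhittakerUnimodularValue{,Split,Inert}`), declared once for the four heads below. -/
variable {dd : F} (hd : δ * δ = algebraMap F E dd) {T₀ : Matrix (Fin 2) (Fin 2) F}
  {JD : Matrix (Fin (2 + 2)) (Fin (2 + 2)) E} (hJD : JD = (gramD F 2 T₀).map (algebraMap F E)) (w₀ : PlacesOver E v)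
  (S : AddSubgroup (Matrix (Fin 2) (Fin 2) (LocalRing E v)))
  (hS : ∀ t, t ∈ S ↔ (t.map (conjLocal E c v))ᵀ * gramS F E v 2 T₀ + gramS F E v 2 T₀ * t = 0)
  [MeasurableSpace S] [BorelSpace S] (μ : Measure S) [μ.IsAddHaarMeasure]
  (h2v : ∀ w : PlacesOver E v, ValuativeRel.valuation (w.1.adicCompletion E) (2 : w.1.adicCompletion E) = 1)
  (hT : ∀ (w : PlacesOver E v) (i j : Fin 2),
    ValuativeRel.valuation (w.1.adicCompletion E) (algebraMap E (w.1.adicCompletion E) (algebraMap F E (T₀ i j))) ≤ 1)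
  (hTinv : ∀ (w : PlacesOver E v) (i j : Fin 2),
    ValuativeRel.valuation (w.1.adicCompletion E) (algebraMap E (w.1.adicCompletion E) (algebraMap F E (T₀⁻¹ i j))) ≤ 1)
  (hTb : ∀ i j (w : PlacesOver E v), Valued.v (gramS F E v 2 T₀ i j w) ≤ Valued.v (toPlace v w π) ^ (0 : ℤ))
  (hTib : ∀ i j (w : PlacesOver E v), Valued.v ((gramS F E v 2 T₀)⁻¹ i j w) ≤ Valued.v (toPlace v w π) ^ (0 : ℤ))
  {χv : ∀ w : PlacesOver E v, (w.1.adicCompletion E)ˣ →* ℂˣ}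
  (hχur : ∀ (w : PlacesOver E v) (x : (w.1.adicCompletion E)ˣ), Valued.v (x : w.1.adicCompletion E) = 1 → χv w x = 1)
  (hϖ0 : ∀ w : PlacesOver E v, toPlace v w π ≠ 0)
  {s : ℂ} {φs : UnitaryGroup.localPi E c (2 + 2) JD v → ℂ}
  {ψ : AddChar (v.adicCompletion F) Circle} (hψ : Continuous ψ) (hdψ : ψ.HasConductorExp 0)
  {τ : LocalRing E v → v.adicCompletion F} (hτ : ∀ r, toLocalRing E v (τ r) = r + conjLocal E c v r) (hτadd : ∀ r s, τ (r + s) = τ r + τ s)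
  (hτs : ∀ (z : v.adicCompletion F) (r : LocalRing E v), τ (toLocalRing E v z * r) = z * τ r) (hτc : Continuous τ)
  (h2F : Valued.v (2 : v.adicCompletion F) = 1)
  {ε : LocalRing E v} (hεσ : conjLocal E c v ε = -ε) (hεint : ∀ w : PlacesOver E v, Valued.v (ε w) ≤ 1)
  (hε : ∀ w : PlacesOver E v, Valued.v (toPlace v w π) ^ (0 : ℤ) ≤ Valued.v ((2 * ε) w))
  (h2 : ∀ w : PlacesOver E v, Valued.v (toPlace v w π) ^ (0 : ℤ) ≤ Valued.v ((2 : LocalRing E v) w))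
  {β βinv : Matrix (Fin 2) (Fin 2) (LocalRing E v)} (hβs : (β.map (conjLocal E c v))ᵀ * gramS F E v 2 T₀ + gramS F E v 2 T₀ * β = 0)
  (hββ : β * βinv = 1) (hβ0 : ∀ i j (w : PlacesOver E v), Valued.v (β i j w) ≤ Valued.v (toPlace v w π) ^ (0 : ℤ))
  (hβinv0 : ∀ i j (w : PlacesOver E v), Valued.v (βinv i j w) ≤ Valued.v (toPlace v w π) ^ (0 : ℤ))

include hcδ hδ hd hJD hπ hπw hS h2v hT hTinv hTb hTib hχur hϖ0 hψ hdψ hτ hτadd hτs hτc h2F hεσ hεint hε h2 hβs hββ hβ0 hβinv0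

/-- **`W° = μ(B(0))·b_{2,v}(s,χ)⁻¹` AT A SPLIT PLACE** (`c • w₀ ≠ w₀`): ★ E6-split `setIntegral_whittaker_unimodular_eq_split` read through §4 `bDen_two_inv_eq_of_split` —
`∫_{B(−3)} φ_s(w_Δ n t) ψ_v(−τ tr(βt)) dμ = μ(B(0)) · (bDen F E c v 2 χv s)⁻¹`, i.e. `μ(B(0))·[L_F(2s+2, χ_F) L_F(2s+1, χ_F η)]⁻¹`, EVERY unramified `χ`, no side condition.
[cite: Liu2011, §2A (2-10)] [cite: HarrisKudlaSweet1996, §6 (6.16)] [cite: Shimura1997, Thm. 13.6] -/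
theorem setIntegral_whittaker_unimodular_eq_bDen_inv_split (hT₀ : T₀.IsSymm) (hT₀d : IsUnit T₀.det)
    (hφ : IsSphericalSection F E c hcδ hδ hd v 2 hT₀ hJD χv s φs) (hw₀ : c • w₀.1 ≠ w₀.1) :
    ∫ t in {t : S | ∀ i j (w : PlacesOver E v), Valued.v (t.1 i j w) ≤ Valued.v (toPlace v w π) ^ (-3 : ℤ)},
        φs (weylDelta F E c v 2 hJD * nElem F E c v 2 hJD t.1 ((hS t.1).1 t.2)) * ((ψ (-τ (Matrix.trace (β * t.1))) : Circle) : ℂ) ∂μ =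
      (μ.real {t : S | ∀ i j (w : PlacesOver E v), Valued.v (t.1 i j w) ≤ Valued.v (toPlace v w π) ^ (0 : ℤ)} : ℂ) *
        (bDen F E c v 2 χv s)⁻¹ := by
  rw [setIntegral_whittaker_unimodular_eq_split F E c hcδ hδ hd v hT₀ hT₀d hJD hπ hπw w₀ hw₀ S hS μ h2v hT hTinv hTb hTib hχur hϖ0 hφ hψ hdψ hτ
    hτadd hτs hτc h2F hεσ hεint hε h2 hβs hββ hβ0 hβinv0, bDen_two_inv_eq_of_split F E c v hπ hπw hχur hϖ0 w₀ hw₀ s]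

/-- **`W° = μ(B(0))·b_{2,v}(s,χ)⁻¹` AT AN INERT UNRAMIFIED PLACE** (`c • w₀ = w₀`, `δ̂` a unit at `w₀`), off the line `α q_v^{−(2s+1)} = 1` (empty for unitary `χ_w`,
`re s ≠ −½`): ★ E6-inert `setIntegral_whittaker_unimodular_eq_inert` read through §4 `bDen_two_inv_eq_of_inert`.
[cite: Liu2011, §2A (2-10)] [cite: HarrisKudlaSweet1996, §6 (6.16)] [cite: Shimura1997, Thm. 13.6] -/
theorem setIntegral_whittaker_unimodular_eq_bDen_inv_inert (hT₀ : T₀.IsSymm) (hT₀d : IsUnit T₀.det)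
    (hφ : IsSphericalSection F E c hcδ hδ hd v 2 hT₀ hJD χv s φs) (hw₀ : c • w₀.1 = w₀.1)
    (hδu : ∀ w : PlacesOver E v, Valued.v (algebraMap E (LocalRing E v) δ w) = 1)
    (hne : (((∏ w : PlacesOver E v, χv w (Units.mk0 (toPlace v w π) (hϖ0 w))) : ℂˣ) : ℂ) * (v.residueCard : ℂ) ^ (-(2 * s + 1)) ≠ 1) :
    ∫ t in {t : S | ∀ i j (w : PlacesOver E v), Valued.v (t.1 i j w) ≤ Valued.v (toPlace v w π) ^ (-3 : ℤ)},
        φs (weylDelta F E c v 2 hJD * nElem F E c v 2 hJD t.1 ((hS t.1).1 t.2)) * ((ψ (-τ (Matrix.trace (β * t.1))) : Circle) : ℂ) ∂μ =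
      (μ.real {t : S | ∀ i j (w : PlacesOver E v), Valued.v (t.1 i j w) ≤ Valued.v (toPlace v w π) ^ (0 : ℤ)} : ℂ) *
        (bDen F E c v 2 χv s)⁻¹ := by
  rw [setIntegral_whittaker_unimodular_eq_inert F E c hcδ hδ hd v hT₀ hT₀d hJD hπ hπw w₀ hw₀ S hS μ h2v hT hTinv hTb hTib hχur hϖ0 hφ hψ hdψ hτ
    hτadd hτs hτc h2F hδu hεσ hεint hε h2 hβs hββ hβ0 hβinv0, bDen_two_inv_eq_of_inert F E c hcδ hδ v hπ hπw hχur hϖ0 w₀ hw₀ s hne]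

/-! ## §6 THE PARITY FORM: `W° = μ(B(0))·(1 − q_v^{−(2s+1)})(1 − α q_v^{−(2s+2)})` under `α = −1` (inert) ∕ `α = +1` (split) -/

/-- **THE PARITY FORM AT AN INERT UNRAMIFIED PLACE.**  If the parity letter holds at `v` — `α := ∏_{w∣v} χ_w(ι_w ϖ) = −1` (= `ε_{E/F}(ϖ_v)` at an inert unramified
place, ★ `K2E1QuadraticHeckeCharCMPlaceValues.valueAtUniformizer_quadraticHeckeCharCM_of_nonsplit`, for `χ|_{𝔸_F^×} = ε_{E/F}`) — then
**`W° = μ(B(0)) · ((1 − q_v^{−(2s+1)}) · (1 − α · q_v^{−(2s+2)}))`** = `μ(B(0))` times the inverse of the `v`-factor of ★ O41.6 `hasProd_b` (`b = ζ_F(2s+1) L(2s+2, ε)`)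
once `α` is read as `ε(ϖ_v)` — RULING M-157p's printed value `μ(B(0))(1 − q_v^{−(2s+1)})(1 − ε(ϖ_v) q_v^{−(2s+2)})`.
[cite: Liu2011, §2A (2-10)] [cite: Harris2007, (1.3.4)] [cite: Shimura1997, Thm. 13.6] -/
theorem setIntegral_whittaker_unimodular_eq_of_parity_inert (hT₀ : T₀.IsSymm) (hT₀d : IsUnit T₀.det)
    (hφ : IsSphericalSection F E c hcδ hδ hd v 2 hT₀ hJD χv s φs) (hw₀ : c • w₀.1 = w₀.1)
    (hδu : ∀ w : PlacesOver E v, Valued.v (algebraMap E (LocalRing E v) δ w) = 1)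
    (hα : (((∏ w : PlacesOver E v, χv w (Units.mk0 (toPlace v w π) (hϖ0 w))) : ℂˣ) : ℂ) = -1) :
    ∫ t in {t : S | ∀ i j (w : PlacesOver E v), Valued.v (t.1 i j w) ≤ Valued.v (toPlace v w π) ^ (-3 : ℤ)},
        φs (weylDelta F E c v 2 hJD * nElem F E c v 2 hJD t.1 ((hS t.1).1 t.2)) * ((ψ (-τ (Matrix.trace (β * t.1))) : Circle) : ℂ) ∂μ =
      (μ.real {t : S | ∀ i j (w : PlacesOver E v), Valued.v (t.1 i j w) ≤ Valued.v (toPlace v w π) ^ (0 : ℤ)} : ℂ) *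
        ((1 - (v.residueCard : ℂ) ^ (-(2 * s + 1))) *
          (1 - (((∏ w : PlacesOver E v, χv w (Units.mk0 (toPlace v w π) (hϖ0 w))) : ℂˣ) : ℂ) * (v.residueCard : ℂ) ^ (-(2 * s + 2)))) := by
  rw [setIntegral_whittaker_unimodular_eq_inert F E c hcδ hδ hd v hT₀ hT₀d hJD hπ hπw w₀ hw₀ S hS μ h2v hT hTinv hTb hTib hχur hϖ0 hφ hψ hdψ hτ
    hτadd hτs hτc h2F hδu hεσ hεint hε h2 hβs hββ hβ0 hβinv0, prod_norm_toPlace_cpow_add_one F E v hπ s, hα, ← residueCard_mul_cpow F v s]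
  ring

/-- **THE PARITY FORM AT A SPLIT PLACE.**  If `α := ∏_{w∣v} χ_w(ι_w ϖ) = 1` (= `ε_{E/F}(ϖ_v)` at a split place, ★
`K2E1QuadraticHeckeCharCMPlaceValues.valueAtUniformizer_quadraticHeckeCharCM_of_split`, for `χ|_{𝔸_F^×} = ε_{E/F}`) then
**`W° = μ(B(0)) · ((1 − q_v^{−(2s+1)}) · (1 − α · q_v^{−(2s+2)}))`** — the same O41.6 shape as at an inert place. [cite: Liu2011, §2A (2-10)] [cite: Harris2007, (1.3.4)] -/
theorem setIntegral_whittaker_unimodular_eq_of_parity_split (hT₀ : T₀.IsSymm) (hT₀d : IsUnit T₀.det)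
    (hφ : IsSphericalSection F E c hcδ hδ hd v 2 hT₀ hJD χv s φs) (hw₀ : c • w₀.1 ≠ w₀.1)
    (hα : (((∏ w : PlacesOver E v, χv w (Units.mk0 (toPlace v w π) (hϖ0 w))) : ℂˣ) : ℂ) = 1) :
    ∫ t in {t : S | ∀ i j (w : PlacesOver E v), Valued.v (t.1 i j w) ≤ Valued.v (toPlace v w π) ^ (-3 : ℤ)},
        φs (weylDelta F E c v 2 hJD * nElem F E c v 2 hJD t.1 ((hS t.1).1 t.2)) * ((ψ (-τ (Matrix.trace (β * t.1))) : Circle) : ℂ) ∂μ =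
      (μ.real {t : S | ∀ i j (w : PlacesOver E v), Valued.v (t.1 i j w) ≤ Valued.v (toPlace v w π) ^ (0 : ℤ)} : ℂ) *
        ((1 - (v.residueCard : ℂ) ^ (-(2 * s + 1))) *
          (1 - (((∏ w : PlacesOver E v, χv w (Units.mk0 (toPlace v w π) (hϖ0 w))) : ℂˣ) : ℂ) * (v.residueCard : ℂ) ^ (-(2 * s + 2)))) := by
  rw [setIntegral_whittaker_unimodular_eq_split F E c hcδ hδ hd v hT₀ hT₀d hJD hπ hπw w₀ hw₀ S hS μ h2v hT hTinv hTb hTib hχur hϖ0 hφ hψ hdψ hτ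
    hτadd hτs hτc h2F hεσ hεint hε h2 hβs hββ hβ0 hβinv0, prod_norm_toPlace_cpow_add_one F E v hπ s, hα, ← residueCard_mul_cpow F v s]
  ring

end Heads

end Summit.HodgeConjecture.HodgeConjecture.Cruxes.HLiu418.K2LiuGoodPlaceWhittakerUnimodularValueCM

end
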